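import Mathlib
import Summits.Ventures.PercRepro2.HCov
import Summits.Ventures.PercRepro2.BHKAvoid
import Summits.Ventures.PercRepro2.ExploreA3
import Summits.Ventures.PercRepro2.RootLeafUSigns
import Summits.Ventures.PercRepro2.RootLeafUHalf
import Summits.Ventures.PercRepro2.RootLeafUOu
import Summits.Ventures.PercRepro2.RootLeafUTowerBHK
import Summits.Ventures.PercRepro2.RootLeafUClaimI

/-!
# The o-pocket `L` half, claim (iii): `A·P(PD, oL) ≥ 2β·P(PD, oL, bK)` for EVERY instance (blind cell PercRepro2,
p4 g24; S3 (G4-u), proofs/P4-G24-OPOCKETL-MASTER.md §4)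

The `t = 0` residual of the master identity route (S3 v88 (am) ADDENDUM) — the value of `T2oL` when `P(T) = 0` —
is a THEOREM for every finite graph and every weight vector: with the whole-instance masses of `T2oL`
(RootLeafUHalf; `A = α + κ`, `β = D + d0·Z`),

  **`claim_iii`**: `0 ≤ A·P(PD, oL) − 2β·P(PD, oL, bK)`.

Proof (`claim_iii_identity`, a `ring` identity after the splits):

  `(iii)/2 = D·(hb·P(PD,oL) − P(PD,oL,bK)) + (1 − d0)·P(PD,oL)·(hb·t′ − P(T′,bK)) + d0·t′·(hb·P(PD,oL) − P(PD,oL,bK))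
           + d0·(P(PD,oL)·P(R,bK) − W·P(PD,oL,bK)) + P(PD,oL)·((1 − d0)·P(PD,bL) − d0·P(T,bL)) + (1 − d0)·P(PD,oL)·P(T′,bL)`,

six products of nonnegative factors, all by exploring `C_u` on `R = {u ↮ a₂, u ↮ c}` (TowerBHK):
`P(PD, oL, bK) ≤ hb·P(PD, oL)` (tower + Harris on `G ∖ C_u` for the decreasing `{c ∉ C_{a₂}}` and the increasing
`{b ∈ C_{a₂}}`), `P(T′, bK) ≤ hb·t′` (`prob_Tp_bK_le`), `W·P(PD, oL, bK) ≤ P(PD, oL)·P(R, bK)` (BHK06 Thm 1.4 with the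
decreasing factor `{c ∉ C_{a₂}}` — NOT the `PD`-conditioned cross-cluster inequality, which is false in general:
the `T` part of `R` is needed), and `d0·P(T, bL) ≤ (1 − d0)·P(PD, bL)` (the tower bound `P(T, bL) ≤ P(a₂ ↔ c)·P(R, bL)`).
-/

namespace Summit.Ventures.PercRepro2

open UnionCluster CovForm

namespace RootLeafU

namespace LMaster

variable {V : Type*} {E : Type*} [Fintype E] [DecidableEq E] [Fintype V] [DecidableEq V]
  {R : Type*} [Field R] [LinearOrder R] [IsStrictOrderedRing R]

variable (p : E → R) (ends : E → Sym2 V) (o a₂ c b u : V)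

omit [Fintype E] [DecidableEq E] [Fintype V] [DecidableEq V] [LinearOrder R] [IsStrictOrderedRing R] in
/-- `{C_{a₂} ∌ c}` is the complement of the connection event. -/
lemma clusterInEvent_notMem_eq : clusterInEvent ends a₂ {W : Set V | c ∉ W} = (connEvent ends a₂ c)ᶜ := by
  ext ω
  simp only [mem_clusterInEvent, Set.mem_setOf_eq, mem_cluster, Set.mem_compl_iff, mem_connEvent]

omit [Fintype E] [DecidableEq E] [Fintype V] [DecidableEq V] [LinearOrder R] [IsStrictOrderedRing R] in
/-- `{C_{a₂} ∌ c, C_{a₂} ∋ b}` as an intersection of the two connection events. -/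
lemma clusterInEvent_inter_eq :
    clusterInEvent ends a₂ ({W : Set V | c ∉ W} ∩ {W : Set V | b ∈ W}) =
      (connEvent ends a₂ c)ᶜ ∩ connEvent ends a₂ b := by
  ext ω
  simp only [mem_clusterInEvent, Set.mem_inter_iff, Set.mem_setOf_eq, mem_cluster, Set.mem_compl_iff,
    mem_connEvent]

omit [Fintype E] [DecidableEq E] [Fintype V] [LinearOrder R] [IsStrictOrderedRing R] in
/-- The event `PD ∩ {o ∈ L}` in exploration form. -/
lemma PD_oL_eq :
    connEvent ends u o ∩ (connEvent ends a₂ c)ᶜ ∩ avoidAll ends u {a₂, c} =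
      PDEvent ends u a₂ c ∩ connEvent ends u o := by
  rw [ISplit.PD_eq_R_inter]
  ext ω
  simp only [Set.mem_inter_iff, Set.mem_compl_iff]
  tauto

omit [Fintype E] [DecidableEq E] [Fintype V] [LinearOrder R] [IsStrictOrderedRing R] in
/-- The event `PD ∩ {o ∈ L} ∩ {b ∈ K}` in exploration form. -/
lemma PD_oL_bK_eq :
    connEvent ends u o ∩ ((connEvent ends a₂ c)ᶜ ∩ connEvent ends a₂ b) ∩ avoidAll ends u {a₂, c} =
      PDEvent ends u a₂ c ∩ (connEvent ends u o ∩ connEvent ends a₂ b) := by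
  rw [ISplit.PD_eq_R_inter]
  ext ω
  simp only [Set.mem_inter_iff, Set.mem_compl_iff]
  tauto

omit [Fintype E] [DecidableEq E] [Fintype V] [LinearOrder R] [IsStrictOrderedRing R] in
/-- The event `T ∩ {b ∈ L}` in exploration form. -/
lemma T_bL_eq :
    connEvent ends u b ∩ connEvent ends a₂ c ∩ avoidAll ends u {a₂, c} =
      TEvent ends u a₂ c ∩ connEvent ends u b := by
  rw [← conn_inter_R]
  ext ω
  simp only [Set.mem_inter_iff]
  tauto

omit [Fintype E] [DecidableEq E] [Fintype V] [DecidableEq V] [LinearOrder R] [IsStrictOrderedRing R] in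
/-- `{C_{a₂} ∌ c}` is a down-set. -/
lemma isLowerSet_notMem_setOf : IsLowerSet {W : Set V | c ∉ W} :=
  fun _ _ h ha hc => ha (h hc)

/-- **Tower + Harris on `G ∖ C_u`**: `P(PD, oL, bK) ≤ hb · P(PD, oL)`. -/
lemma prob_PD_oL_bK_le (hp : IsProbVec p) :
    prob p (PDEvent ends u a₂ c ∩ (connEvent ends u o ∩ connEvent ends a₂ b)) ≤ prob p (connEvent ends a₂ b) * prob p (PDEvent ends u a₂ c ∩ connEvent ends u o) := by
  classical
  have h := TowerBHK.prob_clusterIn_inter_avoid_le_mul_of_lower p ends u a₂ hp (X := {a₂, c})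
    (Finset.mem_insert_self a₂ {c}) {W : Set V | o ∈ W} (isLowerSet_notMem_setOf c)
    (isUpperSet_mem_setOf b)
  rw [← connEvent_eq_clusterInEvent ends u o, clusterInEvent_inter_eq, clusterInEvent_notMem_eq,
    ← connEvent_eq_clusterInEvent ends a₂ b, PD_oL_bK_eq, PD_oL_eq, mul_comm] at h
  exact h

/-- **BHK06 Thm 1.4 with the decreasing factor `{c ∉ C_{a₂}}`**: `W · P(PD, oL, bK) ≤ P(PD, oL) · P(R, bK)`. -/
lemma W_mul_PD_oL_bK_le (hp : IsProbVec p) :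
    prob p (avoidAll ends u {a₂, c}) * prob p (PDEvent ends u a₂ c ∩ (connEvent ends u o ∩ connEvent ends a₂ b)) ≤ prob p (PDEvent ends u a₂ c ∩ connEvent ends u o) * prob p (avoidAll ends u {a₂, c} ∩ connEvent ends a₂ b) := by
  classical
  have h := TowerBHK.bhk_cross_cluster_avoid_lower p ends u a₂ hp (X := {a₂, c})
    (Finset.mem_insert_self a₂ {c}) (isUpperSet_mem_setOf o) (isLowerSet_notMem_setOf c)
    (isUpperSet_mem_setOf b)
  rw [← connEvent_eq_clusterInEvent ends u o, clusterInEvent_inter_eq, clusterInEvent_notMem_eq,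
    ← connEvent_eq_clusterInEvent ends a₂ b, PD_oL_bK_eq, PD_oL_eq,
    Set.inter_comm (connEvent ends a₂ b) (avoidAll ends u {a₂, c}), mul_comm] at h
  exact h

/-- **The tower bound for `T ∩ {b ∈ L}`**: `P(T, bL) ≤ P(R, bL) · P(a₂ ↔ c)`. -/
lemma prob_T_bL_le (hp : IsProbVec p) :
    prob p (TEvent ends u a₂ c ∩ connEvent ends u b) ≤ (prob p (PDEvent ends u a₂ c ∩ connEvent ends u b) + prob p (TEvent ends u a₂ c ∩ connEvent ends u b)) * prob p (connEvent ends a₂ c) := by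
  classical
  have h := TowerBHK.prob_clusterIn_inter_avoid_le_mul p ends u a₂ hp (X := {a₂, c})
    (Finset.mem_insert_self a₂ {c}) {W : Set V | b ∈ W} (isUpperSet_mem_setOf c)
  rw [← connEvent_eq_clusterInEvent ends u b, ← connEvent_eq_clusterInEvent ends a₂ c, T_bL_eq,
    Set.inter_comm (connEvent ends u b) (avoidAll ends u {a₂, c}),
    ← ISplit.prob_PD_add_T p ends u a₂ c (connEvent ends u b)] at h
  exact h

omit [Fintype V] in
/-- **The certificate identity of claim (iii)**: `A·P(PD, oL) − 2β·P(PD, oL, bK)` is twice the sum of six products. -/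
theorem claim_iii_identity :
    ((prob p (PDEvent ends u a₂ c) * prob p (connEvent ends a₂ b) + prob p (avoidAll ends a₂ {c}) * gap p ends u a₂ b) + (prob p Set.univ * EQb3 p ends u a₂ c b + prob p Set.univ * PDb p ends u a₂ c b + prob p (connEvent ends a₂ b) * EQ3 p ends u a₂ c + prob p (connEvent ends a₂ b) * prob p (avoidAll ends a₂ {u}) - (prob p Set.univ - prob p (avoidAll ends a₂ {c})) * gap p ends u a₂ b)) * prob p (PDEvent ends u a₂ c ∩ connEvent ends u o) - 2 * (prob p Set.univ * prob p (PDEvent ends u a₂ c) + prob p (avoidAll ends a₂ {c}) * prob p (avoidAll ends a₂ {u})) * prob p (PDEvent ends u a₂ c ∩ (connEvent ends u o ∩ connEvent ends a₂ b)) =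
      2 * (prob p (PDEvent ends u a₂ c) * (prob p (connEvent ends a₂ b) * prob p (PDEvent ends u a₂ c ∩ connEvent ends u o) - prob p (PDEvent ends u a₂ c ∩ (connEvent ends u o ∩ connEvent ends a₂ b))) + (1 - prob p (avoidAll ends a₂ {c})) * prob p (PDEvent ends u a₂ c ∩ connEvent ends u o) * (prob p (connEvent ends a₂ b) * prob p (TEvent ends a₂ u c) - prob p (TEvent ends a₂ u c ∩ connEvent ends a₂ b)) + prob p (avoidAll ends a₂ {c}) * prob p (TEvent ends a₂ u c) * (prob p (connEvent ends a₂ b) * prob p (PDEvent ends u a₂ c ∩ connEvent ends u o) - prob p (PDEvent ends u a₂ c ∩ (connEvent ends u o ∩ connEvent ends a₂ b))) + prob p (avoidAll ends a₂ {c}) * (prob p (PDEvent ends u a₂ c ∩ connEvent ends u o) * (prob p (PDEvent ends u a₂ c ∩ connEvent ends a₂ b) + prob p (TEvent ends u a₂ c ∩ connEvent ends a₂ b)) - (prob p (PDEvent ends u a₂ c) + prob p (TEvent ends u a₂ c)) * prob p (PDEvent ends u a₂ c ∩ (connEvent ends u o ∩ connEvent ends a₂ b))) + prob p (PDEvent ends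 u a₂ c ∩ connEvent ends u o) * ((1 - prob p (avoidAll ends a₂ {c})) * prob p (PDEvent ends u a₂ c ∩ connEvent ends u b) - prob p (avoidAll ends a₂ {c}) * prob p (TEvent ends u a₂ c ∩ connEvent ends u b)) + (1 - prob p (avoidAll ends a₂ {c})) * prob p (PDEvent ends u a₂ c ∩ connEvent ends u o) * prob p (TEvent ends a₂ u c ∩ connEvent ends u b)) := by
  have hZ := Qsplit_univ p ends u a₂ c
  have hbK := Qsplit p ends u a₂ c (connEvent ends a₂ b)
  have hbL := Qsplit p ends u a₂ c (connEvent ends u b)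
  have hgap := gap_eq_Q p ends u a₂ b
  unfold EQb3 PDb EQ3
  rw [hgap, hZ, hbK, hbL, prob_univ]
  ring

/-- **Claim (iii) for every instance**: `0 ≤ A·P(PD, oL) − 2β·P(PD, oL, bK)`. -/
theorem claim_iii (hp : IsProbVec p) :
    0 ≤ ((prob p (PDEvent ends u a₂ c) * prob p (connEvent ends a₂ b) + prob p (avoidAll ends a₂ {c}) * gap p ends u a₂ b) + (prob p Set.univ * EQb3 p ends u a₂ c b + prob p Set.univ * PDb p ends u a₂ c b + prob p (connEvent ends a₂ b) * EQ3 p ends u a₂ c + prob p (connEvent ends a₂ b) * prob p (avoidAll ends a₂ {u}) - (prob p Set.univ - prob p (avoidAll ends a₂ {c})) * gap p ends u a₂ b)) * prob p (PDEvent ends u a₂ c ∩ connEvent ends u o) - 2 * (prob p Set.univ * prob p (PDEvent ends u a₂ c) + prob p (avoidAll ends a₂ {c}) * prob p (avoidAll ends a₂ {u})) * prob p (PDEvent ends u a₂ c ∩ (connEvent ends u o ∩ connEvent ends a₂ b)) := by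
  classical
  rw [claim_iii_identity]
  have hR : prob p (PDEvent ends u a₂ c) + prob p (TEvent ends u a₂ c) = prob p (avoidAll ends u {a₂, c}) := by
    have h := ISplit.prob_PD_add_T p ends u a₂ c Set.univ
    simpa only [Set.inter_univ] using h
  have hRbK := ISplit.prob_PD_add_T p ends u a₂ c (connEvent ends a₂ b)
  have hd0 : prob p (avoidAll ends a₂ {c}) = 1 - prob p (connEvent ends a₂ c) := by
    rw [avoidAll_singleton_eq, prob_compl]
  have hc' : prob p (connEvent ends a₂ c) = 1 - prob p (avoidAll ends a₂ {c}) := by linarith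
  have G1 := prob_PD_oL_bK_le p ends o a₂ c b u hp
  have G2 := prob_Tp_bK_le p ends a₂ c b u hp
  have G3 := W_mul_PD_oL_bK_le p ends o a₂ c b u hp
  have G4 := prob_T_bL_le p ends a₂ c b u hp
  rw [← hR, ← hRbK] at G3
  rw [hc'] at G4
  have n_d0 := prob_nonneg hp (avoidAll ends a₂ {c})
  have n_D := prob_nonneg hp (PDEvent ends u a₂ c)
  have n_tp := prob_nonneg hp (TEvent ends a₂ u c)
  have n_PDoL := prob_nonneg hp (PDEvent ends u a₂ c ∩ connEvent ends u o)
  have n_TpbL := prob_nonneg hp (TEvent ends a₂ u c ∩ connEvent ends u b)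
  have n_1d0 : 0 ≤ 1 - prob p (avoidAll ends a₂ {c}) := by linarith [prob_le_one hp (avoidAll ends a₂ {c})]
  have g1 : 0 ≤ prob p (PDEvent ends u a₂ c) * (prob p (connEvent ends a₂ b) * prob p (PDEvent ends u a₂ c ∩ connEvent ends u o) - prob p (PDEvent ends u a₂ c ∩ (connEvent ends u o ∩ connEvent ends a₂ b))) := mul_nonneg n_D (by linarith)
  have g2 : 0 ≤ (1 - prob p (avoidAll ends a₂ {c})) * prob p (PDEvent ends u a₂ c ∩ connEvent ends u o) * (prob p (connEvent ends a₂ b) * prob p (TEvent ends a₂ u c) - prob p (TEvent ends a₂ u c ∩ connEvent ends a₂ b)) := mul_nonneg (mul_nonneg n_1d0 n_PDoL) (by linarith)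
  have g3 : 0 ≤ prob p (avoidAll ends a₂ {c}) * prob p (TEvent ends a₂ u c) * (prob p (connEvent ends a₂ b) * prob p (PDEvent ends u a₂ c ∩ connEvent ends u o) - prob p (PDEvent ends u a₂ c ∩ (connEvent ends u o ∩ connEvent ends a₂ b))) := mul_nonneg (mul_nonneg n_d0 n_tp) (by linarith)
  have g4 : 0 ≤ prob p (avoidAll ends a₂ {c}) * (prob p (PDEvent ends u a₂ c ∩ connEvent ends u o) * (prob p (PDEvent ends u a₂ c ∩ connEvent ends a₂ b) + prob p (TEvent ends u a₂ c ∩ connEvent ends a₂ b)) - (prob p (PDEvent ends u a₂ c) + prob p (TEvent ends u a₂ c)) * prob p (PDEvent ends u a₂ c ∩ (connEvent ends u o ∩ connEvent ends a₂ b))) := mul_nonneg n_d0 (by linarith)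
  have g5 : 0 ≤ prob p (PDEvent ends u a₂ c ∩ connEvent ends u o) * ((1 - prob p (avoidAll ends a₂ {c})) * prob p (PDEvent ends u a₂ c ∩ connEvent ends u b) - prob p (avoidAll ends a₂ {c}) * prob p (TEvent ends u a₂ c ∩ connEvent ends u b)) := mul_nonneg n_PDoL (by linarith)
  have g6 : 0 ≤ (1 - prob p (avoidAll ends a₂ {c})) * prob p (PDEvent ends u a₂ c ∩ connEvent ends u o) * prob p (TEvent ends a₂ u c ∩ connEvent ends u b) := mul_nonneg (mul_nonneg n_1d0 n_PDoL) n_TpbL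
  linarith

end LMaster

end RootLeafU

end Summit.Ventures.PercRepro2
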